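import Summits.RiemannHypothesis.RiemannHypothesis.Theorems.IntegerScrewScrewPolyFloorZeroExpansion
import Literature.NumberTheory.LFunctions.ZetaScrewProp31Proofs

/-!
# Splittings — SCREW NULL COMBINATIONS III: the zero-side expansion of a combination of kernel sections

Cell rh-split (brief sha16 f79c5f09d8bcb036), seat rh-split-typer-2 g3 (prover; own initiative on the cross/screw column,
announced HOME/STATUS.md 01:50Z): residual **R2** of target T2 (`ETAIL ⟺ FOZ`) of `cards/SPLIT-screw-bridge.md` §8/§9.  The seat
rh-split-screw-bridge g4 re-expressed R2 («FOZ ⟹ the screw Gram matrices are eventually nonsingular») as «FOZ ⟹ NNC»,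
NNC = «no non-zero finite real combination `t ↦ Σ_{j<n} z_j G_g(t, log(j+2))` of kernel sections vanishes at every node
`log(i+2)`» (`Splittings/ScrewBridgeRigidity.lean`, `inertiaOfFoz_iff_foz_imp_nnc`).  This file is part III of VI, step (ii):
for every real `t`, `Σ_j G_g(t, log(j+2)) z_j = Σ_ρ m(ρ)(ρ−½)^{-2} R_z(ρ−½)(e^{(ρ−½)t} − 1)` absolutely (`hasSum_nodeComb`), where
`R_z(w) = Σ_j z_j (1 − (j+2)^{−w})`, from the tree's unconditional kernel series (Suzuki 2023 (1.9) = Thm 1.1 (2),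
`IntegerScrewLandau.hasSum_kernel` over `Suzuki2023_thm11_series_holds`) folded by the reflection `ρ ↦ 1 − ρ`
(`ZetaScrewProp31.one_sub_mem_and_zeroOrder`); summability from `ZetaScrewProp31.summable_zeroOrder_div_norm_sub_half_sq`
(`Σ m(ρ)/‖ρ−½‖² < ∞`).  All [folklore] plumbing around cited tree inputs.

HONEST LABEL: an RH-free theorem about Suzuki's screw kernel GIVEN finitely many off-line zeros; it discharges the residual
R2 of a CONDITIONAL bridge (cell rh-split: «SPLITTING SEARCH over kernel-typed RH-EQUIVALENCES; a splitting A ∧ B ⟹ RH is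
CONDITIONAL bookkeeping unless A and B are both proved») and nothing here bears on the truth of RH.
-/

set_option linter.dupNamespace false

noncomputable section

namespace Summit.RiemannHypothesis.RiemannHypothesis.Theorems.Splittings.ScrewNullComb


open Filter Topology Complex Finset
open Literature.NumberTheory.LFunctions
open Summit.RiemannHypothesis.RiemannHypothesis.Theorems.IntegerScrewLandau

/-! ## Per-zero algebra -/

/-- The symmetrisation identity behind Suzuki's (1.9):
`(1 − e^{−wu})(e^{wt} − 1) + (1 − e^{wu})(e^{−wt} − 1) = 2(cosh wt + cosh wu − cosh w(t−u) − 1)`. [folklore] -/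
theorem brk_symm (w : ℂ) (t u : ℂ) :
    (1 - Complex.exp (-(w * u))) * (Complex.exp (w * t) - 1) +
        (1 - Complex.exp (-(-w * u))) * (Complex.exp (-w * t) - 1) =
      2 * (Complex.cosh (w * t) + Complex.cosh (w * u) - Complex.cosh (w * (t - u)) - 1) := by
  have hA : Complex.exp (w * t) ≠ 0 := Complex.exp_ne_zero _
  have hB : Complex.exp (w * u) ≠ 0 := Complex.exp_ne_zero _
  simp only [Complex.cosh, neg_mul, neg_neg, Complex.exp_neg, mul_sub, Complex.exp_sub]
  field_simp
  ring

/-- Norm of `e^{-wu}` for `|Re w| ≤ 1/2`, `u ≥ 0`. [folklore] -/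
theorem norm_exp_neg_mul_le {w : ℂ} (hw : |w.re| ≤ 1 / 2) {u : ℝ} (hu : 0 ≤ u) :
    ‖Complex.exp (-(w * u))‖ ≤ Real.exp (u / 2) := by
  rw [Complex.norm_exp]
  apply Real.exp_le_exp.2
  have : (-(w * (u : ℂ))).re = -(w.re * u) := by simp
  rw [this]
  have h := (abs_le.1 hw).1
  nlinarith

/-- Norm of `e^{wt}` for `|Re w| ≤ 1/2`. [folklore] -/
theorem norm_exp_mul_le {w : ℂ} (hw : |w.re| ≤ 1 / 2) (t : ℝ) :
    ‖Complex.exp (w * t)‖ ≤ Real.exp (|t| / 2) := by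
  rw [Complex.norm_exp]
  apply Real.exp_le_exp.2
  have : (w * (t : ℂ)).re = w.re * t := by simp
  rw [this]
  have h1 := abs_le.1 hw
  have : w.re * t ≤ |w.re| * |t| := by
    rw [← abs_mul]; exact le_abs_self _
  nlinarith [abs_nonneg t, abs_nonneg w.re]

/-! ## The coefficient `R_z(w) = Σ_j z_j (1 − (j+2)^{−w})` and its bound -/

/-- `‖R_z(w)‖ ≤ Σ_j |z_j| (1 + (j+2)^{1/2})` for `|Re w| ≤ 1/2`. [folklore] -/
theorem norm_R_le (n : ℕ) (z : Fin n → ℝ) {w : ℂ} (hw : |w.re| ≤ 1 / 2) :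
    ‖∑ j : Fin n, (z j : ℂ) * (1 - Complex.exp (-(w * (Real.log (((j : ℕ) + 2 : ℕ) : ℝ) : ℂ))))‖ ≤
      ∑ j : Fin n, |z j| * (1 + Real.exp (Real.log (((j : ℕ) + 2 : ℕ) : ℝ) / 2)) := by
  refine (norm_sum_le _ _).trans (Finset.sum_le_sum fun j _ ↦ ?_)
  rw [norm_mul, Complex.norm_real, Real.norm_eq_abs]
  refine mul_le_mul_of_nonneg_left ?_ (abs_nonneg _)
  have hu : 0 ≤ Real.log (((j : ℕ) + 2 : ℕ) : ℝ) :=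
    Real.log_nonneg (by exact_mod_cast (show 1 ≤ (j : ℕ) + 2 by omega))
  calc ‖(1 : ℂ) - Complex.exp (-(w * (Real.log (((j : ℕ) + 2 : ℕ) : ℝ) : ℂ)))‖
      ≤ ‖(1 : ℂ)‖ + ‖Complex.exp (-(w * (Real.log (((j : ℕ) + 2 : ℕ) : ℝ) : ℂ)))‖ := norm_sub_le _ _
    _ ≤ 1 + Real.exp (Real.log (((j : ℕ) + 2 : ℕ) : ℝ) / 2) := by
        rw [norm_one]; gcongr; exact norm_exp_neg_mul_le hw hu

/-! ## The zero set: elementary facts -/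

/-- `|Re(ρ − ½)| ≤ ½` for a non-trivial zero. [folklore] -/
theorem abs_re_sub_half_le (ρ : ZetaZeros.riemannZetaNontrivialZeros) : |((ρ : ℂ) - 1 / 2).re| ≤ 1 / 2 := by
  have h0 := ZetaZeros.riemannZetaNontrivialZeros.re_pos ρ.2
  have h1 := ZetaZeros.riemannZetaNontrivialZeros.re_lt_one ρ.2
  have : ((ρ : ℂ) - 1 / 2).re = (ρ : ℂ).re - 1 / 2 := by simp
  rw [this, abs_le]; constructor <;> linarith

/-- `ρ − ½ ≠ 0` for a non-trivial zero. [folklore] -/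
theorem sub_half_ne_zero (ρ : ZetaZeros.riemannZetaNontrivialZeros) : (ρ : ℂ) - 1 / 2 ≠ 0 := by
  intro h
  have him := ZetaZeros.riemannZetaNontrivialZeros.im_ne_zero ρ.2
  have : ((ρ : ℂ) - 1 / 2).im = 0 := by rw [h]; simp
  simp at this
  exact him this

/-- The multiplicity of a non-trivial zero is a positive integer. [folklore] -/
theorem zeroOrder_pos (ρ : ZetaZeros.riemannZetaNontrivialZeros) : 0 < riemannZetaZeroOrder (ρ : ℂ) :=
  lt_of_lt_of_le zero_lt_one (ZetaZeros.riemannZetaNontrivialZeros.one_le_order ρ.2)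

/-- The norm of the complex weight `m(ρ)/(ρ−½)²`. [folklore] -/
theorem norm_weight (ρ : ZetaZeros.riemannZetaNontrivialZeros) :
    ‖(riemannZetaZeroOrder (ρ : ℂ) : ℂ) / ((ρ : ℂ) - 1 / 2) ^ 2‖ =
      (riemannZetaZeroOrder (ρ : ℂ) : ℝ) / ‖(ρ : ℂ) - 1 / 2‖ ^ 2 := by
  rw [norm_div, norm_pow, Complex.norm_intCast, abs_of_pos (by exact_mod_cast zeroOrder_pos ρ)]

/-- Per-zero identity: the average of the `ρ`- and `(1−ρ)`-terms of `a(ρ)(e^{wt} − 1)` is the `ρ`-term of (1.9)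
summed against `z`. [folklore] -/
theorem term_symm {n : ℕ} (zC u : Fin n → ℂ) (m w t : ℂ) :
    (1 / 2 : ℂ) * (m / w ^ 2 * (∑ j : Fin n, zC j * (1 - Complex.exp (-(w * u j)))) * (Complex.exp (w * t) - 1) +
        m / (-w) ^ 2 * (∑ j : Fin n, zC j * (1 - Complex.exp (-(-w * u j)))) * (Complex.exp (-w * t) - 1)) =
      ∑ j : Fin n, zC j * (m * ((Complex.cosh (w * t) - 1) / w ^ 2) + m * ((Complex.cosh (w * u j) - 1) / w ^ 2) -
        m * ((Complex.cosh (w * (t - u j)) - 1) / w ^ 2)) := by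
  rw [neg_sq, Finset.mul_sum, Finset.mul_sum, Finset.sum_mul, Finset.sum_mul, ← Finset.sum_add_distrib,
    Finset.mul_sum]
  refine Finset.sum_congr rfl fun j _ ↦ ?_
  have hb := brk_symm w t (u j)
  linear_combination (m * zC j / (2 * w ^ 2)) * hb

/-! ## The expansion `F(t) = Σ_ρ a(ρ) (e^{(ρ−½)t} − 1)` -/

section Expansion

variable (n : ℕ) (z : Fin n → ℝ)

/-- **Summability of the coefficients** `a(ρ) = m(ρ)(ρ−½)^{-2} R_z(ρ−½)`:
`Σ_ρ ‖a(ρ)‖ < ∞` (from `Σ m(ρ)/‖ρ−½‖² < ∞`). [folklore] -/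
theorem summable_norm_coeff :
    Summable fun ρ : ZetaZeros.riemannZetaNontrivialZeros ↦
      ‖(riemannZetaZeroOrder (ρ : ℂ) : ℂ) / ((ρ : ℂ) - 1 / 2) ^ 2 *
        ∑ j : Fin n, (z j : ℂ) * (1 - Complex.exp (-(((ρ : ℂ) - 1 / 2) * (Real.log (((j : ℕ) + 2 : ℕ) : ℝ) : ℂ))))‖ := by
  set Zc : ℝ := ∑ j : Fin n, |z j| * (1 + Real.exp (Real.log (((j : ℕ) + 2 : ℕ) : ℝ) / 2)) with hZc
  refine Summable.of_nonneg_of_le (fun _ ↦ norm_nonneg _) (fun ρ ↦ ?_)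
    (ZetaScrewProp31.summable_zeroOrder_div_norm_sub_half_sq.mul_right Zc)
  rw [norm_mul, norm_weight]
  exact mul_le_mul_of_nonneg_left (norm_R_le n z (abs_re_sub_half_le ρ))
    (div_nonneg (by exact_mod_cast (zeroOrder_pos ρ).le) (by positivity))

/-- Summability of `a(ρ)` itself. [folklore] -/
theorem summable_coeff :
    Summable fun ρ : ZetaZeros.riemannZetaNontrivialZeros ↦
      (riemannZetaZeroOrder (ρ : ℂ) : ℂ) / ((ρ : ℂ) - 1 / 2) ^ 2 *
        ∑ j : Fin n, (z j : ℂ) * (1 - Complex.exp (-(((ρ : ℂ) - 1 / 2) * (Real.log (((j : ℕ) + 2 : ℕ) : ℝ) : ℂ)))) :=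
  (summable_norm_coeff n z).of_norm

/-- Summability of `a(ρ) e^{(ρ−½)t}` (`‖e^{(ρ−½)t}‖ ≤ e^{|t|/2}`). [folklore] -/
theorem summable_coeff_mul_exp (t : ℝ) :
    Summable fun ρ : ZetaZeros.riemannZetaNontrivialZeros ↦
      (riemannZetaZeroOrder (ρ : ℂ) : ℂ) / ((ρ : ℂ) - 1 / 2) ^ 2 *
        (∑ j : Fin n, (z j : ℂ) * (1 - Complex.exp (-(((ρ : ℂ) - 1 / 2) * (Real.log (((j : ℕ) + 2 : ℕ) : ℝ) : ℂ))))) *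
        Complex.exp (((ρ : ℂ) - 1 / 2) * t) := by
  refine Summable.of_norm_bounded ((summable_norm_coeff n z).mul_right (Real.exp (|t| / 2))) fun ρ ↦ ?_
  rw [norm_mul]
  exact mul_le_mul_of_nonneg_left (norm_exp_mul_le (abs_re_sub_half_le ρ) t) (norm_nonneg _)

/-- **The zero-side expansion of a combination of kernel sections** (Suzuki's (1.9) summed against `z`, with the
reflection `ρ ↦ 1 − ρ` folding the two halves): for every real `t`,
`Σ_j G_g(t, log(j+2)) z_j = Σ_ρ m(ρ)(ρ−½)^{-2} R_z(ρ−½) (e^{(ρ−½)t} − 1)`, absolutely convergent,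
`R_z(w) = Σ_j z_j (1 − (j+2)^{-w})`. [folklore] -/
theorem hasSum_nodeComb (t : ℝ) :
    HasSum (fun ρ : ZetaZeros.riemannZetaNontrivialZeros ↦
      (riemannZetaZeroOrder (ρ : ℂ) : ℂ) / ((ρ : ℂ) - 1 / 2) ^ 2 *
        (∑ j : Fin n, (z j : ℂ) * (1 - Complex.exp (-(((ρ : ℂ) - 1 / 2) * (Real.log (((j : ℕ) + 2 : ℕ) : ℝ) : ℂ))))) *
        (Complex.exp (((ρ : ℂ) - 1 / 2) * t) - 1))
      ((∑ j : Fin n, zetaScrewKernel t (Real.log (((j : ℕ) + 2 : ℕ) : ℝ)) * z j : ℝ) : ℂ) := by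
  -- the raw series from (1.9)
  have hP : HasSum (fun ρ : ZetaZeros.riemannZetaNontrivialZeros ↦ ∑ j : Fin n, (z j : ℂ) *
      ((riemannZetaZeroOrder (ρ : ℂ) : ℂ) *
          ((Complex.cosh (((ρ : ℂ) - 1 / 2) * t) - 1) / ((ρ : ℂ) - 1 / 2) ^ 2) +
        (riemannZetaZeroOrder (ρ : ℂ) : ℂ) *
          ((Complex.cosh (((ρ : ℂ) - 1 / 2) * (Real.log (((j : ℕ) + 2 : ℕ) : ℝ))) - 1) / ((ρ : ℂ) - 1 / 2) ^ 2) -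
        (riemannZetaZeroOrder (ρ : ℂ) : ℂ) *
          ((Complex.cosh (((ρ : ℂ) - 1 / 2) * (t - Real.log (((j : ℕ) + 2 : ℕ) : ℝ) : ℝ)) - 1) /
            ((ρ : ℂ) - 1 / 2) ^ 2)))
      (∑ j : Fin n, (z j : ℂ) * (zetaScrewKernel t (Real.log (((j : ℕ) + 2 : ℕ) : ℝ)) : ℂ)) := by
    have h := hasSum_sum (s := (Finset.univ : Finset (Fin n))) fun j _ ↦
      (hasSum_kernel t (Real.log (((j : ℕ) + 2 : ℕ) : ℝ))).mul_left (z j : ℂ)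
    push_cast at h ⊢
    exact h
  -- the summable family `Q(ρ) = a(ρ)(e^{wt} − 1)` and its reflection
  set Q : ZetaZeros.riemannZetaNontrivialZeros → ℂ := fun ρ ↦
      (riemannZetaZeroOrder (ρ : ℂ) : ℂ) / ((ρ : ℂ) - 1 / 2) ^ 2 *
        (∑ j : Fin n, (z j : ℂ) * (1 - Complex.exp (-(((ρ : ℂ) - 1 / 2) * (Real.log (((j : ℕ) + 2 : ℕ) : ℝ) : ℂ))))) *
        (Complex.exp (((ρ : ℂ) - 1 / 2) * t) - 1) with hQdef
  have hQ : Summable Q := by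
    refine ((summable_coeff_mul_exp n z t).sub (summable_coeff n z)).congr fun ρ ↦ ?_
    simp only [hQdef]; ring
  have hQsum := hQ.hasSum
  let r : ZetaZeros.riemannZetaNontrivialZeros → ZetaZeros.riemannZetaNontrivialZeros :=
    fun ρ ↦ ⟨1 - (ρ : ℂ), (ZetaScrewProp31.one_sub_mem_and_zeroOrder ρ).1⟩
  have hr : Function.Involutive r := fun ρ ↦ Subtype.ext (by simp [r])
  have hQr : HasSum (Q ∘ (hr.toPerm r)) (∑' ρ, Q ρ) := (Equiv.hasSum_iff (hr.toPerm r)).2 hQsum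
  have h2 := (hQsum.add hQr).mul_left (1 / 2 : ℂ)
  have e2 : (1 / 2 : ℂ) * ((∑' ρ, Q ρ) + ∑' ρ, Q ρ) = ∑' ρ, Q ρ := by ring
  rw [e2] at h2
  -- termwise, the symmetrised family is the raw series
  have h3 : HasSum (fun ρ : ZetaZeros.riemannZetaNontrivialZeros ↦ ∑ j : Fin n, (z j : ℂ) *
      ((riemannZetaZeroOrder (ρ : ℂ) : ℂ) *
          ((Complex.cosh (((ρ : ℂ) - 1 / 2) * t) - 1) / ((ρ : ℂ) - 1 / 2) ^ 2) +
        (riemannZetaZeroOrder (ρ : ℂ) : ℂ) *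
          ((Complex.cosh (((ρ : ℂ) - 1 / 2) * (Real.log (((j : ℕ) + 2 : ℕ) : ℝ))) - 1) / ((ρ : ℂ) - 1 / 2) ^ 2) -
        (riemannZetaZeroOrder (ρ : ℂ) : ℂ) *
          ((Complex.cosh (((ρ : ℂ) - 1 / 2) * (t - Real.log (((j : ℕ) + 2 : ℕ) : ℝ) : ℝ)) - 1) /
            ((ρ : ℂ) - 1 / 2) ^ 2)))
      (∑' ρ, Q ρ) := by
    refine h2.congr_fun fun ρ ↦ ?_
    simp only [Function.comp_apply, Function.Involutive.coe_toPerm, hQdef, r]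
    rw [(ZetaScrewProp31.one_sub_mem_and_zeroOrder ρ).2,
      show (1 : ℂ) - (ρ : ℂ) - 1 / 2 = -((ρ : ℂ) - 1 / 2) by ring]
    have := term_symm (fun j ↦ (z j : ℂ)) (fun j ↦ (Real.log (((j : ℕ) + 2 : ℕ) : ℝ) : ℂ))
      (riemannZetaZeroOrder (ρ : ℂ) : ℂ) ((ρ : ℂ) - 1 / 2) t
    push_cast at this ⊢
    rw [this]
  have e3 : ((∑ j : Fin n, zetaScrewKernel t (Real.log (((j : ℕ) + 2 : ℕ) : ℝ)) * z j : ℝ) : ℂ) =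
      ∑ j : Fin n, (z j : ℂ) * (zetaScrewKernel t (Real.log (((j : ℕ) + 2 : ℕ) : ℝ)) : ℂ) := by
    push_cast
    exact Finset.sum_congr rfl fun j _ ↦ mul_comm _ _
  rw [e3, hP.unique h3]
  exact hQsum

end Expansion

end Summit.RiemannHypothesis.RiemannHypothesis.Theorems.Splittings.ScrewNullComb

end
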